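import Summits.QuantumFields.YangMills.Theorems.BalabanUVNodesN15PartitionTwoGridFit
import Summits.QuantumFields.YangMills.Theorems.BalabanUVNodesN15PartitionThirdDifference
import HarnessLib

/-!
# THE QUADRATIC PARTITION OF UNITY (2.36), VI: the TWO-GRID FIT OF THE SECOND DERIVATIVE `|∇′*_μ∇′_μh′_k(x′) − (∇*_μ∇_μh_k)(πx′)| ≤ κ²·s·π³(144 + 32|J|)` (FILE 46's `hf2`,
# `o₂ = (144 + 32|J|)π³∕(nM³)` at `s = 1∕(nM)`, `κ = 1∕M`) and of the BACKWARD derivative `|∇′⁻_μh′_k(x′) − (∇⁻_μh_k)(πx′)| ≤ |κ|·s·(64π² + π²|J|)` (FILE 46's `hf1b`) for the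
# sampled partitions at two spacings — by DISCRETE telescoping of second-difference quotients against FILE V's third-difference letter (dag-n15-w4 g0, width seat on N15 = NE2;
# dag-n15-c g11's located item (Γ17); s1 «background-layer OPERATOR ingredient»)

Cell `pub-ymgap`, seat `pub-ymgap-dag-n15-w4` (director №399 (3a) width; HUMAN RULING D-0062), generation 0.  `bears_on: R4∕N15 · K3⁷ SpineGivenEndpointR13SepCoPH
(stmt-QuantumFields-20544)`.  Filed `--supports stmt-QuantumFields-20544 --as helper` — COUNT-NEUTRAL.  Theorems only (0 `def`, 0 `sorry`).  Imports BY NAME dag-n15-c FILE 64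
`…N15PartitionTwoGridFit` (`abs_diff_thetaPer_shift_le`, `thetaPer_telescope`; through it FILE 61 `hcube`, `hcube_shift`, `hcube_shift_symm`, `prod_shift_eq`, `prod_shift_eq'`,
`hcube_eq_mul`, `prod_erase_mem`, `abs_prod_sub_prod_le`, FILE 60 `thetaPer`, `thetaPer_add_int_mul`, `abs_thetaPer_sub_le`, `abs_thetaPer_second_diff_le`, g8 `fgrad`, `bgrad`,
`fgradAdj`) and this seat's FILE V `…N15PartitionThirdDifference` (`abs_thetaPer_third_diff_le`).  Nothing in the tree is modified.

WHY.  FILE 46 `hasMaj_idef_commOp_lapOp_comp` ∕ FILE 50's bundle display, for the partition at two spacings, the fits `hf1 : |∇′_μh′ − (∇_μh)∘π| ≤ o₁` (FILE 64), `hf1b : |∇′⁻_μh′ −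
(∇⁻_μh)∘π| ≤ o₁` and `hf2 : |∇′*_μ∇′_μh′ − (∇*_μ∇_μh)∘π| ≤ o₂`; the last two were NOT typed (dag-n15-c g11 ■-line, located (Γ17)).  For the sampled partition `h = hcube K ξ k` (FILE
61) at coarse step `s` and fine step `s′ = s∕L` with `ns = n′s′ = κ`: `∇*_μ∇_μh = −n²·[Θ_K(u+s) − 2Θ_K(u) + Θ_K(u−s)]·Π_{ν≠μ}Θ_K`, and the coarse second difference DOUBLE-TELESCOPES,
`SD_{Ls′}(u) = Σ_{a,b<L} SD_{s′}(u + (a+b+1−L)s′)` (★ `second_diff_telescope`, any `f`), so `n′²SD_{s′}(u′) − n²SD_s(u) = κ²∕(L²s′²)·Σ_{a,b}[SD_{s′}(u′) − SD_{s′}(u + (a+b+1−L)s′)]`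
and each bracket is at most `2L` third differences (★ `abs_sd_thetaPer_shift_le`: the drift `|SD_{s′}(v + ps′) − SD_{s′}(v)| ≤ p·72π³s′³` from FILE V): ★★ `abs_sdq_thetaPer_sub_le`
— `|n′²SD_{s′}(u′) − n²SD_s(u)| ≤ 144π³κ²s` for `u′ = u + is′ + zK`, `0 ≤ i ≤ L`; on the product carriers the complementary products contribute `n²|SD_s|·π|J|s ≤ 32π³|J|κ²s`:
★★★ `abs_fgradAdj_fgrad_hcube_two_grid_le` (FILE 46's `hf2`).  §3 is the backward twin of FILE 64: ★ `abs_bdq_thetaPer_sub_le` (same drift lemma, fine offsets `L + i − 1 − j ∈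
[0, 2L)` above the coarse telescope) and ★★ `abs_bgrad_hcube_two_grid_le` (FILE 46's `hf1b`, FILE 64's constant `|κ|·s·(64π² + π²|J|)`).

HONEST FRAMING ∕ LIMITS.  Elementary (finite telescoping + FILE V's letters); [B6] (2.36) p.229 and [B9] Thm 3.14 pp.426–427 (difference template) are SHAPES only — nothing
of [B5]∕[B6]∕[B9] asserted.  With FILES 61∕64 every partition hypothesis `hh, h236, hh1, hh1b, hh2, hfit, hf1, hf1b, hf2` of FILES 45–58 is now dischargeable by name from torus
coordinates with the shift compatibility and the block offsets `0 ≤ i_ν ≤ L` (the consumer's data, displayed).  NE2⁺ NOT PRINTED, NOT proved; N15 NOT discharged; counts of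
record UNMOVED (typed 28∕28 · discharged 5∕27); one finite 𝕋⁴ at fixed ε — NOT infinite volume, NOT OS on ℝ⁴, NOT a mass gap, NOT Clay; R4 closes the conditional
finite-𝕋⁴ rung `BalabanLadder.UV` only.  Restate-immune (no Theses import).
-/

noncomputable section

namespace Summit.QuantumFields.YangMills.BalabanUVNodes.N15.Gluing

open Real
open Summit.QuantumFields.YangMills.BalabanUVNodes.N15.BackgroundLayer (fgrad fgradAdj bgrad fgrad_apply fgradAdj_apply bgrad_apply)

/-! ## §1 One coordinate: drift of the second difference, the double telescope, the second-difference-quotient fit -/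

section OneDim

variable {K : ℕ}

/-- ★ **DRIFT OF THE SECOND DIFFERENCE**: `SD(w) := Θ_K(w + s′) − 2Θ_K(w) + Θ_K(w − s′)` moves by at most `72π³s′³` per step (one third difference each):
`|SD(v + ps′) − SD(v)| ≤ p·72π³s′³` (`0 ≤ s′ ≤ 1∕3`, `K ≥ 2`). [folklore] -/
theorem abs_sd_thetaPer_shift_le (hK : 2 ≤ K) {s' : ℝ} (hs : 0 ≤ s') (hs1 : s' ≤ 1 / 3) (v : ℝ) (p : ℕ) :
    |(thetaPer K (v + p * s' + s') - 2 * thetaPer K (v + p * s') + thetaPer K (v + p * s' - s'))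
      - (thetaPer K (v + s') - 2 * thetaPer K v + thetaPer K (v - s'))| ≤ p * (72 * π ^ 3 * s' ^ 3) := by
  induction p with
  | zero => simp
  | succ p ih =>
      have step := abs_thetaPer_third_diff_le (u := v + p * s' - s') hK hs hs1
      push_cast
      calc |thetaPer K (v + (p + 1) * s' + s') - 2 * thetaPer K (v + (p + 1) * s') + thetaPer K (v + (p + 1) * s' - s')
              - (thetaPer K (v + s') - 2 * thetaPer K v + thetaPer K (v - s'))|
          = |(thetaPer K (v + p * s' - s' + 3 * s') - 3 * thetaPer K (v + p * s' - s' + 2 * s') + 3 * thetaPer K (v + p * s' - s' + s') - thetaPer K (v + p * s' - s'))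
              + ((thetaPer K (v + p * s' + s') - 2 * thetaPer K (v + p * s') + thetaPer K (v + p * s' - s'))
                - (thetaPer K (v + s') - 2 * thetaPer K v + thetaPer K (v - s')))| := by ring_nf
        _ ≤ 72 * π ^ 3 * s' ^ 3 + p * (72 * π ^ 3 * s' ^ 3) := (abs_add_le _ _).trans (add_le_add step ih)
        _ = (p + 1) * (72 * π ^ 3 * s' ^ 3) := by ring

/-- ★ **THE DOUBLE TELESCOPE** (any `f`): `f(u + Ls′) − 2f(u) + f(u − Ls′) = Σ_{a<L} Σ_{b<L} [f(w + s′) − 2f(w) + f(w − s′)]_{w = u + (a+b+1−L)s′}` — the coarse second difference is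
a triangular-weighted sum of `L²` fine ones. [folklore] -/
theorem second_diff_telescope (f : ℝ → ℝ) (u s' : ℝ) (L : ℕ) :
    f (u + L * s') - 2 * f u + f (u - L * s') =
      ∑ a ∈ Finset.range L, ∑ b ∈ Finset.range L,
        (f (u + ((a : ℝ) + b + 1 - L) * s' + s') - 2 * f (u + ((a : ℝ) + b + 1 - L) * s') + f (u + ((a : ℝ) + b + 1 - L) * s' - s')) := by
  -- inner telescope in `b` of `D(w) = f(w + s′) − f(w)` along `w = u + (a − L + b)s′`
  have inner : ∀ a : ℕ, ∑ b ∈ Finset.range L,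
      (f (u + ((a : ℝ) + b + 1 - L) * s' + s') - 2 * f (u + ((a : ℝ) + b + 1 - L) * s') + f (u + ((a : ℝ) + b + 1 - L) * s' - s'))
      = (f (u + (a : ℝ) * s' + s') - f (u + (a : ℝ) * s')) - (f (u + ((a : ℝ) - L) * s' + s') - f (u + ((a : ℝ) - L) * s')) := by
    intro a
    have t := Finset.sum_range_sub (fun b : ℕ => f (u + ((a : ℝ) - L + b) * s' + s') - f (u + ((a : ℝ) - L + b) * s')) L
    simp only [Nat.cast_add, Nat.cast_one, Nat.cast_zero, add_zero] at t
    rw [show (a : ℝ) - L + L = a by ring] at t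
    rw [← t]
    refine Finset.sum_congr rfl fun b _ => ?_
    rw [show (a : ℝ) - L + (b + 1) = (a : ℝ) + b + 1 - L by ring, show u + ((a : ℝ) - L + b) * s' + s' = u + ((a : ℝ) + b + 1 - L) * s' by ring,
      show u + ((a : ℝ) - L + b) * s' = u + ((a : ℝ) + b + 1 - L) * s' - s' by ring]
    ring
  rw [Finset.sum_congr rfl fun a _ => inner a, Finset.sum_sub_distrib]
  have t1 := Finset.sum_range_sub (fun a : ℕ => f (u + (a : ℝ) * s')) L
  have t2 := Finset.sum_range_sub (fun a : ℕ => f (u + ((a : ℝ) - L) * s')) L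
  simp only [Nat.cast_add, Nat.cast_one, Nat.cast_zero, zero_mul, add_zero, sub_self, zero_sub] at t1 t2
  have e1 : ∑ a ∈ Finset.range L, (f (u + (a : ℝ) * s' + s') - f (u + (a : ℝ) * s')) = f (u + L * s') - f u := by
    rw [← t1]; refine Finset.sum_congr rfl fun a _ => ?_; rw [show u + ((a : ℝ) + 1) * s' = u + (a : ℝ) * s' + s' by ring]
  have e2 : ∑ a ∈ Finset.range L, (f (u + ((a : ℝ) - L) * s' + s') - f (u + ((a : ℝ) - L) * s')) = f u - f (u - L * s') := by
    rw [show u + -(L : ℝ) * s' = u - L * s' by ring] at t2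
    rw [← t2]
    refine Finset.sum_congr rfl fun a _ => ?_
    rw [show u + ((a : ℝ) + 1 - L) * s' = u + ((a : ℝ) - L) * s' + s' by ring]
  rw [e1, e2]; ring

/-- ★★ **THE SECOND-DIFFERENCE-QUOTIENT FIT**: `s = Ls′`, `ns = n′s′ = κ`, `u′ = u + is′ + zK` with `0 ≤ i ≤ L`, `0 ≤ s′ ≤ 1∕3`, `K ≥ 2` ⟹
`|n′²(Θ_K(u′+s′) − 2Θ_K(u′) + Θ_K(u′−s′)) − n²(Θ_K(u+s) − 2Θ_K(u) + Θ_K(u−s))| ≤ 144π³·κ²·s`. [cite: Balaban1985BackgroundPropagators, Thm 3.14 pp.426–427 (difference template: shape)] -/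
theorem abs_sdq_thetaPer_sub_le (hK : 2 ≤ K) {s s' κ n n' u u' : ℝ} {L : ℕ} {i : ℕ} {z : ℤ} (hL : 1 ≤ L) (hs : 0 ≤ s') (hs1 : s' ≤ 1 / 3) (hsL : s = L * s')
    (hn : n * s = κ) (hn' : n' * s' = κ) (hi : i ≤ L) (hu' : u' = u + i * s' + z * K) :
    |n' ^ 2 * (thetaPer K (u' + s') - 2 * thetaPer K u' + thetaPer K (u' - s')) - n ^ 2 * (thetaPer K (u + s) - 2 * thetaPer K u + thetaPer K (u - s))|
      ≤ 144 * π ^ 3 * κ ^ 2 * s := by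
  have hK0 : 0 < K := by omega
  have hLr : (1 : ℝ) ≤ L := by exact_mod_cast hL
  have hLpos : (0 : ℝ) < L := by linarith
  -- remove the period
  have e1 : thetaPer K (u' + s') = thetaPer K (u + i * s' + s') := by
    rw [hu', show u + i * s' + z * K + s' = (u + i * s' + s') + z * K by ring, thetaPer_add_int_mul hK0]
  have e2 : thetaPer K u' = thetaPer K (u + i * s') := by rw [hu', thetaPer_add_int_mul hK0]
  have e3 : thetaPer K (u' - s') = thetaPer K (u + i * s' - s') := by
    rw [hu', show u + i * s' + z * K - s' = (u + i * s' - s') + z * K by ring, thetaPer_add_int_mul hK0]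
  rw [e1, e2, e3, hsL, second_diff_telescope (thetaPer K) u s' L]
  -- the degenerate case s′ = 0
  rcases eq_or_lt_of_le hs with hs0 | hs0
  · rw [← hs0]
    have z0 : thetaPer K u - 2 * thetaPer K u + thetaPer K u = 0 := by ring
    simp [z0]
  have hn_eq : n = κ / (L * s') := by rw [← hn, hsL]; field_simp
  have hn'_eq : n' = κ / s' := by rw [← hn']; field_simp
  obtain ⟨SD, hSD⟩ : ∃ SD : ℝ → ℝ, ∀ w : ℝ, thetaPer K (w + s') - 2 * thetaPer K w + thetaPer K (w - s') = SD w := ⟨_, fun _ => rfl⟩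
  have hX : 0 ≤ 72 * π ^ 3 * s' ^ 3 := by positivity
  -- two-offset drift from the base v = u + (1 − L)s′
  obtain ⟨v, hv⟩ : ∃ v : ℝ, v = u + (1 - (L : ℝ)) * s' := ⟨_, rfl⟩
  have hdrift2 : ∀ p q : ℕ, p ≤ q → |SD (v + q * s') - SD (v + p * s')| ≤ ((q - p : ℕ) : ℝ) * (72 * π ^ 3 * s' ^ 3) := by
    intro p q hpq
    have h := abs_sd_thetaPer_shift_le hK hs hs1 (v + p * s') (q - p)
    rw [hSD, hSD, show v + p * s' + ((q - p : ℕ) : ℝ) * s' = v + q * s' by rw [Nat.cast_sub hpq]; ring] at h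
    exact h
  have hpair : ∀ a b : ℕ, a < L → b < L → |SD (u + i * s') - SD (u + ((a : ℝ) + b + 1 - L) * s')| ≤ 2 * L * (72 * π ^ 3 * s' ^ 3) := by
    intro a b ha hb
    have ei : u + i * s' = v + ((i + L - 1 : ℕ) : ℝ) * s' := by
      rw [hv, Nat.cast_sub (by omega : 1 ≤ i + L), Nat.cast_add, Nat.cast_one]; ring
    have eab : u + ((a : ℝ) + b + 1 - L) * s' = v + ((a + b : ℕ) : ℝ) * s' := by rw [hv, Nat.cast_add]; ring
    rw [ei, eab]
    rcases le_total (a + b) (i + L - 1) with hle | hle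
    · refine (hdrift2 _ _ hle).trans (mul_le_mul_of_nonneg_right ?_ hX)
      have : (i + L - 1 - (a + b) : ℕ) ≤ 2 * L := by omega
      exact_mod_cast this
    · rw [abs_sub_comm]
      refine (hdrift2 _ _ hle).trans (mul_le_mul_of_nonneg_right ?_ hX)
      have : (a + b - (i + L - 1) : ℕ) ≤ 2 * L := by omega
      exact_mod_cast this
  simp only [hSD]
  have key : n' ^ 2 * SD (u + i * s') - n ^ 2 * ∑ a ∈ Finset.range L, ∑ b ∈ Finset.range L, SD (u + ((a : ℝ) + b + 1 - L) * s')
      = κ ^ 2 / (L ^ 2 * s' ^ 2) * ∑ a ∈ Finset.range L, ∑ b ∈ Finset.range L, (SD (u + i * s') - SD (u + ((a : ℝ) + b + 1 - L) * s')) := by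
    rw [hn_eq, hn'_eq]
    simp only [Finset.sum_sub_distrib, Finset.sum_const, Finset.card_range, nsmul_eq_mul]
    field_simp
  have hsum : |∑ a ∈ Finset.range L, ∑ b ∈ Finset.range L, (SD (u + i * s') - SD (u + ((a : ℝ) + b + 1 - L) * s'))| ≤ L * (L * (2 * L * (72 * π ^ 3 * s' ^ 3))) := by
    refine (Finset.abs_sum_le_sum_abs _ _).trans ?_
    calc ∑ a ∈ Finset.range L, |∑ b ∈ Finset.range L, (SD (u + i * s') - SD (u + ((a : ℝ) + b + 1 - L) * s'))|
        ≤ ∑ a ∈ Finset.range L, L * (2 * L * (72 * π ^ 3 * s' ^ 3)) := by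
          refine Finset.sum_le_sum fun a ha => (Finset.abs_sum_le_sum_abs _ _).trans ?_
          calc ∑ b ∈ Finset.range L, |SD (u + i * s') - SD (u + ((a : ℝ) + b + 1 - L) * s')| ≤ ∑ b ∈ Finset.range L, 2 * L * (72 * π ^ 3 * s' ^ 3) :=
                Finset.sum_le_sum fun b hb => hpair a b (Finset.mem_range.1 ha) (Finset.mem_range.1 hb)
            _ = L * (2 * L * (72 * π ^ 3 * s' ^ 3)) := by rw [Finset.sum_const, Finset.card_range, nsmul_eq_mul]
      _ = L * (L * (2 * L * (72 * π ^ 3 * s' ^ 3))) := by rw [Finset.sum_const, Finset.card_range, nsmul_eq_mul]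
  rw [key, abs_mul, abs_of_nonneg (by positivity : (0 : ℝ) ≤ κ ^ 2 / (L ^ 2 * s' ^ 2))]
  calc κ ^ 2 / (L ^ 2 * s' ^ 2) * |∑ a ∈ Finset.range L, ∑ b ∈ Finset.range L, (SD (u + i * s') - SD (u + ((a : ℝ) + b + 1 - L) * s'))|
      ≤ κ ^ 2 / (L ^ 2 * s' ^ 2) * (L * (L * (2 * L * (72 * π ^ 3 * s' ^ 3)))) := mul_le_mul_of_nonneg_left hsum (by positivity)
    _ = 144 * π ^ 3 * κ ^ 2 * (L * s') := by field_simp; ring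

/-- ★ **THE BACKWARD DIFFERENCE-QUOTIENT FIT** (twin of FILE 64 `abs_dq_thetaPer_sub_le`): `s = Ls′`, `ns = n′s′ = κ`, `u′ = u + is′ + zK` with `0 ≤ i ≤ L`, `0 ≤ s′ ≤ 1`, `K ≥ 2` ⟹
`|n′(Θ_K(u′) − Θ_K(u′ − s′)) − n(Θ_K(u) − Θ_K(u − s))| ≤ 64π²·|κ|·s` (the fine pair sits `L + i − 1 ∈ [L − 1, 2L)` fine steps above the coarse backward foot).
[cite: Balaban1985BackgroundPropagators, Thm 3.14 pp.426–427 (difference template: shape)] -/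
theorem abs_bdq_thetaPer_sub_le (hK : 2 ≤ K) {s s' κ n n' u u' : ℝ} {L : ℕ} {i : ℕ} {z : ℤ} (hL : 1 ≤ L) (hs : 0 ≤ s') (hs1 : s' ≤ 1) (hsL : s = L * s') (hn : n * s = κ)
    (hn' : n' * s' = κ) (hi : i ≤ L) (hu' : u' = u + i * s' + z * K) :
    |n' * (thetaPer K u' - thetaPer K (u' - s')) - n * (thetaPer K u - thetaPer K (u - s))| ≤ 64 * π ^ 2 * |κ| * s := by
  have hK0 : 0 < K := by omega
  have hLr : (1 : ℝ) ≤ L := by exact_mod_cast hL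
  have hLpos : (0 : ℝ) < L := by linarith
  -- the coarse backward foot v = u − s = u − Ls′
  obtain ⟨v, hv⟩ : ∃ v : ℝ, u = v + L * s' := ⟨u - L * s', by ring⟩
  have hq1 : 1 ≤ L + i := by omega
  have e1 : thetaPer K u' = thetaPer K (v + ((L + i - 1 : ℕ) : ℝ) * s' + s') := by
    rw [hu', hv, thetaPer_add_int_mul hK0, Nat.cast_sub hq1, Nat.cast_add, Nat.cast_one]; ring_nf
  have e2 : thetaPer K (u' - s') = thetaPer K (v + ((L + i - 1 : ℕ) : ℝ) * s') := by
    rw [hu', hv, show v + L * s' + i * s' + z * K - s' = (v + L * s' + i * s' - s') + z * K by ring, thetaPer_add_int_mul hK0, Nat.cast_sub hq1, Nat.cast_add,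
      Nat.cast_one]; ring_nf
  rw [e1, e2, hv, hsL, show v + L * s' - L * s' = v by ring, thetaPer_telescope]
  rcases eq_or_lt_of_le hs with hs0 | hs0
  · rw [← hs0]; simp
  have hn_eq : n = κ / (L * s') := by rw [← hn, hsL]; field_simp
  have hn'_eq : n' = κ / s' := by rw [← hn']; field_simp
  obtain ⟨D, hD⟩ : ∃ D : ℕ → ℝ, ∀ j : ℕ, thetaPer K (v + j * s' + s') - thetaPer K (v + j * s') = D j := ⟨_, fun _ => rfl⟩
  obtain ⟨q, hq⟩ : ∃ q : ℕ, q = L + i - 1 := ⟨_, rfl⟩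
  rw [← hq]
  have hC : 0 ≤ 32 * π ^ 2 * s' ^ 2 := by positivity
  have hdrift : ∀ j : ℕ, j < L → |D q - D j| ≤ 2 * L * (32 * π ^ 2 * s' ^ 2) := by
    intro j hj
    have hjq : j ≤ q := by omega
    have h := abs_diff_thetaPer_shift_le hK hs hs1 (v + j * s') (q - j)
    rw [show v + j * s' + ((q - j : ℕ) : ℝ) * s' = v + q * s' by rw [Nat.cast_sub hjq]; ring, hD, hD] at h
    refine h.trans (mul_le_mul_of_nonneg_right ?_ hC)
    have : (q - j : ℕ) ≤ 2 * L := by omega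
    exact_mod_cast this
  simp only [hD]
  have key : n' * D q - n * ∑ j ∈ Finset.range L, D j = (κ / (L * s')) * ∑ j ∈ Finset.range L, (D q - D j) := by
    rw [hn_eq, hn'_eq, Finset.sum_sub_distrib, Finset.sum_const, Finset.card_range, nsmul_eq_mul]
    field_simp
  have hsum : |∑ j ∈ Finset.range L, (D q - D j)| ≤ L * (2 * L * (32 * π ^ 2 * s' ^ 2)) := by
    refine (Finset.abs_sum_le_sum_abs _ _).trans ?_
    calc ∑ j ∈ Finset.range L, |D q - D j| ≤ ∑ j ∈ Finset.range L, 2 * L * (32 * π ^ 2 * s' ^ 2) :=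
          Finset.sum_le_sum fun j hj => hdrift j (Finset.mem_range.1 hj)
      _ = L * (2 * L * (32 * π ^ 2 * s' ^ 2)) := by rw [Finset.sum_const, Finset.card_range, nsmul_eq_mul]
  rw [key, abs_mul, abs_div, abs_mul, abs_of_pos hLpos, abs_of_pos hs0]
  calc |κ| / (L * s') * |∑ j ∈ Finset.range L, (D q - D j)| ≤ |κ| / (L * s') * (L * (2 * L * (32 * π ^ 2 * s' ^ 2))) :=
        mul_le_mul_of_nonneg_left hsum (by positivity)
    _ = 64 * π ^ 2 * |κ| * (L * s') := by field_simp; ring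

end OneDim

/-! ## §2 The product carriers: FILE 46's `o₂` and backward `o₁` -/

section Lattice

variable {X X' : Type} {J : Type} [Fintype J] [DecidableEq J] (K : ℕ) (ξ : J → X → ℝ) (ξ' : J → X' → ℝ) (pr : X' → X) (e : J → X ≃ X) (e' : J → X' ≃ X')

/-- ★★★ **THE TWO-GRID FIT OF `∇*∇h`** (FILE 46's `hf2` with `o₂ = κ²·s·π³(144 + 32|J|)`, `κ = ns = n′s′`, i.e. `o₂ = (144 + 32|J|)π³∕(nM³)` at `s = 1∕(nM)`, `κ = 1∕M`):
coarse∕fine coordinates with the shift compatibilities, `s = Ls′`, `0 ≤ s′ ≤ 1∕3`, `s ≤ 1`, `K ≥ 2`, and every fine coordinate offset from its coarse image by `i_ν s′ (mod K)` with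
`0 ≤ i_ν ≤ L` ⟹ `|fgradAdj n′ (e′ μ) (fgrad n′ (e′ μ) (hcube K ξ′ k)) x′ − fgradAdj n (e μ) (fgrad n (e μ) (hcube K ξ k)) (πx′)| ≤ κ²·s·(144π³ + 32π³|J|)`.
[cite: Balaban1984PropagatorsII, (2.36) p.229; Balaban1985BackgroundPropagators, Thm 3.14 pp.426–427 (difference template)] -/
theorem abs_fgradAdj_fgrad_hcube_two_grid_le (hK : 2 ≤ K) {s s' κ n n' : ℝ} {L : ℕ} (hL : 1 ≤ L) (hs : 0 ≤ s') (hs1 : s' ≤ 1 / 3) (hs2 : s ≤ 1) (hsL : s = L * s')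
    (hn : n * s = κ) (hn' : n' * s' = κ)
    (hξ : ∀ μ ν x, ∃ z : ℤ, ξ ν (e μ x) = ξ ν x + (if ν = μ then s else 0) + z * K) (hξ' : ∀ μ ν x', ∃ z : ℤ, ξ' ν (e' μ x') = ξ' ν x' + (if ν = μ then s' else 0) + z * K)
    (hoff : ∀ ν x', ∃ i : ℕ, i ≤ L ∧ ∃ z : ℤ, ξ' ν x' = ξ ν (pr x') + i * s' + z * K) (k : J → ZMod K) (μ : J) (x' : X') :
    |fgradAdj n' (e' μ) (fgrad n' (e' μ) (hcube K ξ' k)) x' - fgradAdj n (e μ) (fgrad n (e μ) (hcube K ξ k)) (pr x')|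
      ≤ κ ^ 2 * s * (144 * π ^ 3 + 32 * π ^ 3 * Fintype.card J) := by
  have hK0 : 0 < K := by omega
  have hsnn : 0 ≤ s := by rw [hsL]; positivity
  simp only [fgradAdj_apply, fgrad_apply, Equiv.apply_symm_apply]
  rw [hcube_shift K ξ' e' hK0 hξ', prod_shift_eq, hcube_shift_symm K ξ' e' hK0 hξ', prod_shift_eq', hcube_eq_mul K ξ' k μ x',
    hcube_shift K ξ e hK0 hξ, prod_shift_eq, hcube_shift_symm K ξ e hK0 hξ, prod_shift_eq', hcube_eq_mul K ξ k μ (pr x')]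
  have regroup : ∀ n₁ n₂ A₁ B₁ C₁ A₂ B₂ C₂ P₁ P₂ : ℝ,
      n₁ * (n₁ * (B₁ * P₁ - C₁ * P₁) - n₁ * (A₁ * P₁ - B₁ * P₁)) - n₂ * (n₂ * (B₂ * P₂ - C₂ * P₂) - n₂ * (A₂ * P₂ - B₂ * P₂))
        = -((n₁ ^ 2 * (A₁ - 2 * B₁ + C₁) - n₂ ^ 2 * (A₂ - 2 * B₂ + C₂)) * P₁ + n₂ ^ 2 * (A₂ - 2 * B₂ + C₂) * (P₁ - P₂)) := by
    intros; ring
  rw [regroup, abs_neg]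
  have hP' := prod_erase_mem K ξ' k μ x'
  -- the one-coordinate second-difference-quotient fit
  obtain ⟨i, hi, z, hz⟩ := hoff μ x'
  have hu' : ξ' μ x' - ((k μ).val : ℝ) = (ξ μ (pr x') - ((k μ).val : ℝ)) + i * s' + z * K := by rw [hz]; ring
  have t1 := abs_sdq_thetaPer_sub_le hK hL hs hs1 hsL hn hn' hi hu'
  rw [show ξ μ (pr x') - ((k μ).val : ℝ) + s = ξ μ (pr x') + s - ((k μ).val : ℝ) by ring, show ξ μ (pr x') - ((k μ).val : ℝ) - s = ξ μ (pr x') - s - ((k μ).val : ℝ) by ring,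
    show ξ' μ x' - ((k μ).val : ℝ) + s' = ξ' μ x' + s' - ((k μ).val : ℝ) by ring, show ξ' μ x' - ((k μ).val : ℝ) - s' = ξ' μ x' - s' - ((k μ).val : ℝ) by ring] at t1
  -- the coarse second difference and the drift of the complementary products
  have hSD : |thetaPer K (ξ μ (pr x') + s - ((k μ).val : ℝ)) - 2 * thetaPer K (ξ μ (pr x') - ((k μ).val : ℝ)) + thetaPer K (ξ μ (pr x') - s - ((k μ).val : ℝ))|
      ≤ 32 * π ^ 2 * s ^ 2 := by
    have := abs_thetaPer_second_diff_le (u := ξ μ (pr x') - ((k μ).val : ℝ)) hK hsnn hs2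
    rwa [show ξ μ (pr x') - ((k μ).val : ℝ) + s = ξ μ (pr x') + s - ((k μ).val : ℝ) by ring,
      show ξ μ (pr x') - ((k μ).val : ℝ) - s = ξ μ (pr x') - s - ((k μ).val : ℝ) by ring] at this
  have hPP : |(∏ ν ∈ Finset.univ.erase μ, thetaPer K (ξ' ν x' - ((k ν).val : ℝ))) - ∏ ν ∈ Finset.univ.erase μ, thetaPer K (ξ ν (pr x') - ((k ν).val : ℝ))|
      ≤ Fintype.card J * (π * s) := by
    refine (abs_prod_sub_prod_le (Finset.univ.erase μ) _ _ (fun ν => ⟨thetaPer_nonneg K _, (le_abs_self _).trans (abs_thetaPer_le_one K _)⟩)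
      (fun ν => ⟨thetaPer_nonneg K _, (le_abs_self _).trans (abs_thetaPer_le_one K _)⟩)).trans ?_
    have hterm : ∀ ν ∈ Finset.univ.erase μ, |thetaPer K (ξ' ν x' - ((k ν).val : ℝ)) - thetaPer K (ξ ν (pr x') - ((k ν).val : ℝ))| ≤ π * s := by
      intro ν _
      obtain ⟨iν, hiν, zν, hzν⟩ := hoff ν x'
      rw [hzν, show ξ ν (pr x') + iν * s' + zν * K - ((k ν).val : ℝ) = (ξ ν (pr x') + iν * s' - ((k ν).val : ℝ)) + zν * K by ring, thetaPer_add_int_mul hK0]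
      refine (abs_thetaPer_sub_le hK0 _ _).trans ?_
      rw [show ξ ν (pr x') + iν * s' - ((k ν).val : ℝ) - (ξ ν (pr x') - ((k ν).val : ℝ)) = iν * s' by ring, abs_of_nonneg (by positivity)]
      have : (iν : ℝ) * s' ≤ L * s' := mul_le_mul_of_nonneg_right (by exact_mod_cast hiν) hs
      rw [hsL]; exact mul_le_mul_of_nonneg_left this Real.pi_pos.le
    calc ∑ ν ∈ Finset.univ.erase μ, |thetaPer K (ξ' ν x' - ((k ν).val : ℝ)) - thetaPer K (ξ ν (pr x') - ((k ν).val : ℝ))|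
        ≤ ∑ ν ∈ Finset.univ.erase μ, π * s := Finset.sum_le_sum hterm
      _ = (Finset.univ.erase μ).card * (π * s) := by rw [Finset.sum_const, nsmul_eq_mul]
      _ ≤ Fintype.card J * (π * s) := by
          refine mul_le_mul_of_nonneg_right ?_ (by positivity)
          exact_mod_cast (Finset.card_erase_le).trans (Finset.card_univ (α := J)).le
  have hns : n ^ 2 * s ^ 2 = κ ^ 2 := by rw [← hn]; ring
  refine (abs_add_le _ _).trans ?_
  rw [abs_mul, abs_mul, abs_mul, abs_of_nonneg hP'.1, abs_of_nonneg (sq_nonneg n)]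
  have b1 : |n' ^ 2 * (thetaPer K (ξ' μ x' + s' - ((k μ).val : ℝ)) - 2 * thetaPer K (ξ' μ x' - ((k μ).val : ℝ)) + thetaPer K (ξ' μ x' - s' - ((k μ).val : ℝ)))
      - n ^ 2 * (thetaPer K (ξ μ (pr x') + s - ((k μ).val : ℝ)) - 2 * thetaPer K (ξ μ (pr x') - ((k μ).val : ℝ)) + thetaPer K (ξ μ (pr x') - s - ((k μ).val : ℝ)))| *
      ∏ ν ∈ Finset.univ.erase μ, thetaPer K (ξ' ν x' - ((k ν).val : ℝ)) ≤ 144 * π ^ 3 * κ ^ 2 * s := (mul_le_of_le_one_right (abs_nonneg _) hP'.2).trans t1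
  have b2 : n ^ 2 * |thetaPer K (ξ μ (pr x') + s - ((k μ).val : ℝ)) - 2 * thetaPer K (ξ μ (pr x') - ((k μ).val : ℝ)) + thetaPer K (ξ μ (pr x') - s - ((k μ).val : ℝ))| *
      |(∏ ν ∈ Finset.univ.erase μ, thetaPer K (ξ' ν x' - ((k ν).val : ℝ))) - ∏ ν ∈ Finset.univ.erase μ, thetaPer K (ξ ν (pr x') - ((k ν).val : ℝ))| ≤
      n ^ 2 * (32 * π ^ 2 * s ^ 2) * (Fintype.card J * (π * s)) := mul_le_mul (mul_le_mul_of_nonneg_left hSD (sq_nonneg _)) hPP (abs_nonneg _) (by positivity)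
  calc _ ≤ 144 * π ^ 3 * κ ^ 2 * s + n ^ 2 * (32 * π ^ 2 * s ^ 2) * (Fintype.card J * (π * s)) := add_le_add b1 b2
    _ = κ ^ 2 * s * (144 * π ^ 3 + 32 * π ^ 3 * Fintype.card J) := by linear_combination (32 * π ^ 3 * Fintype.card J * s) * hns

/-- ★★ **THE TWO-GRID FIT OF THE BACKWARD DERIVATIVE `∇⁻h`** (FILE 46's `hf1b` with FILE 64's `o₁ = |κ|·s·(64 + |J|)π²`): same hypotheses as FILE 64 `abs_fgrad_hcube_two_grid_le` ⟹
`|bgrad n′ (e′ μ) (hcube K ξ′ k) x′ − bgrad n (e μ) (hcube K ξ k) (πx′)| ≤ |κ|·s·(64π² + π²|J|)`. [cite: Balaban1984PropagatorsII, (2.36) p.229; Balaban1985BackgroundPropagators, Thm 3.14 pp.426–427 (difference template)] -/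
theorem abs_bgrad_hcube_two_grid_le (hK : 2 ≤ K) {s s' κ n n' : ℝ} {L : ℕ} (hL : 1 ≤ L) (hs : 0 ≤ s') (hs1 : s' ≤ 1) (hsL : s = L * s') (hn : n * s = κ) (hn' : n' * s' = κ)
    (hξ : ∀ μ ν x, ∃ z : ℤ, ξ ν (e μ x) = ξ ν x + (if ν = μ then s else 0) + z * K) (hξ' : ∀ μ ν x', ∃ z : ℤ, ξ' ν (e' μ x') = ξ' ν x' + (if ν = μ then s' else 0) + z * K)
    (hoff : ∀ ν x', ∃ i : ℕ, i ≤ L ∧ ∃ z : ℤ, ξ' ν x' = ξ ν (pr x') + i * s' + z * K) (k : J → ZMod K) (μ : J) (x' : X') :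
    |bgrad n' (e' μ) (hcube K ξ' k) x' - bgrad n (e μ) (hcube K ξ k) (pr x')| ≤ |κ| * s * (64 * π ^ 2 + π ^ 2 * Fintype.card J) := by
  have hK0 : 0 < K := by omega
  have hsnn : 0 ≤ s := by rw [hsL]; positivity
  rw [bgrad_apply, bgrad_apply, hcube_shift_symm K ξ' e' hK0 hξ', prod_shift_eq', hcube_eq_mul K ξ' k μ x', hcube_shift_symm K ξ e hK0 hξ, prod_shift_eq',
    hcube_eq_mul K ξ k μ (pr x')]
  have regroup : ∀ n₁ n₂ A₁ B₁ A₂ B₂ P₁ P₂ : ℝ, n₁ * (A₁ * P₁ - B₁ * P₁) - n₂ * (A₂ * P₂ - B₂ * P₂) = (n₁ * (A₁ - B₁) - n₂ * (A₂ - B₂)) * P₁ + n₂ * (A₂ - B₂) * (P₁ - P₂) := by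
    intros; ring
  rw [regroup]
  have hP' := prod_erase_mem K ξ' k μ x'
  obtain ⟨i, hi, z, hz⟩ := hoff μ x'
  have hu' : ξ' μ x' - ((k μ).val : ℝ) = (ξ μ (pr x') - ((k μ).val : ℝ)) + i * s' + z * K := by rw [hz]; ring
  have t1 := abs_bdq_thetaPer_sub_le hK hL hs hs1 hsL hn hn' hi hu'
  rw [show ξ μ (pr x') - ((k μ).val : ℝ) - s = ξ μ (pr x') - s - ((k μ).val : ℝ) by ring, show ξ' μ x' - ((k μ).val : ℝ) - s' = ξ' μ x' - s' - ((k μ).val : ℝ) by ring] at t1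
  have hΔ : |thetaPer K (ξ μ (pr x') - ((k μ).val : ℝ)) - thetaPer K (ξ μ (pr x') - s - ((k μ).val : ℝ))| ≤ π * s := by
    refine (abs_thetaPer_sub_le hK0 _ _).trans (le_of_eq ?_)
    rw [show ξ μ (pr x') - ((k μ).val : ℝ) - (ξ μ (pr x') - s - ((k μ).val : ℝ)) = s by ring, abs_of_nonneg hsnn]
  have hPP : |(∏ ν ∈ Finset.univ.erase μ, thetaPer K (ξ' ν x' - ((k ν).val : ℝ))) - ∏ ν ∈ Finset.univ.erase μ, thetaPer K (ξ ν (pr x') - ((k ν).val : ℝ))|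
      ≤ Fintype.card J * (π * s) := by
    refine (abs_prod_sub_prod_le (Finset.univ.erase μ) _ _ (fun ν => ⟨thetaPer_nonneg K _, (le_abs_self _).trans (abs_thetaPer_le_one K _)⟩)
      (fun ν => ⟨thetaPer_nonneg K _, (le_abs_self _).trans (abs_thetaPer_le_one K _)⟩)).trans ?_
    have hterm : ∀ ν ∈ Finset.univ.erase μ, |thetaPer K (ξ' ν x' - ((k ν).val : ℝ)) - thetaPer K (ξ ν (pr x') - ((k ν).val : ℝ))| ≤ π * s := by
      intro ν _
      obtain ⟨iν, hiν, zν, hzν⟩ := hoff ν x'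
      rw [hzν, show ξ ν (pr x') + iν * s' + zν * K - ((k ν).val : ℝ) = (ξ ν (pr x') + iν * s' - ((k ν).val : ℝ)) + zν * K by ring, thetaPer_add_int_mul hK0]
      refine (abs_thetaPer_sub_le hK0 _ _).trans ?_
      rw [show ξ ν (pr x') + iν * s' - ((k ν).val : ℝ) - (ξ ν (pr x') - ((k ν).val : ℝ)) = iν * s' by ring, abs_of_nonneg (by positivity)]
      have : (iν : ℝ) * s' ≤ L * s' := mul_le_mul_of_nonneg_right (by exact_mod_cast hiν) hs
      rw [hsL]; exact mul_le_mul_of_nonneg_left this Real.pi_pos.le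
    calc ∑ ν ∈ Finset.univ.erase μ, |thetaPer K (ξ' ν x' - ((k ν).val : ℝ)) - thetaPer K (ξ ν (pr x') - ((k ν).val : ℝ))|
        ≤ ∑ ν ∈ Finset.univ.erase μ, π * s := Finset.sum_le_sum hterm
      _ = (Finset.univ.erase μ).card * (π * s) := by rw [Finset.sum_const, nsmul_eq_mul]
      _ ≤ Fintype.card J * (π * s) := by
          refine mul_le_mul_of_nonneg_right ?_ (by positivity)
          exact_mod_cast (Finset.card_erase_le).trans (Finset.card_univ (α := J)).le
  have hns : |n| * s = |κ| := by rw [← hn, abs_mul, abs_of_nonneg hsnn]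
  refine (abs_add_le _ _).trans ?_
  rw [abs_mul, abs_mul, abs_mul, abs_of_nonneg hP'.1]
  have b1 : |n' * (thetaPer K (ξ' μ x' - ((k μ).val : ℝ)) - thetaPer K (ξ' μ x' - s' - ((k μ).val : ℝ))) -
      n * (thetaPer K (ξ μ (pr x') - ((k μ).val : ℝ)) - thetaPer K (ξ μ (pr x') - s - ((k μ).val : ℝ)))| *
      ∏ ν ∈ Finset.univ.erase μ, thetaPer K (ξ' ν x' - ((k ν).val : ℝ)) ≤ 64 * π ^ 2 * |κ| * s := (mul_le_of_le_one_right (abs_nonneg _) hP'.2).trans t1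
  have b2 : |n| * |thetaPer K (ξ μ (pr x') - ((k μ).val : ℝ)) - thetaPer K (ξ μ (pr x') - s - ((k μ).val : ℝ))| *
      |(∏ ν ∈ Finset.univ.erase μ, thetaPer K (ξ' ν x' - ((k ν).val : ℝ))) - ∏ ν ∈ Finset.univ.erase μ, thetaPer K (ξ ν (pr x') - ((k ν).val : ℝ))| ≤
      |n| * (π * s) * (Fintype.card J * (π * s)) := mul_le_mul (mul_le_mul_of_nonneg_left hΔ (abs_nonneg _)) hPP (abs_nonneg _) (by positivity)
  calc _ ≤ 64 * π ^ 2 * |κ| * s + |n| * (π * s) * (Fintype.card J * (π * s)) := add_le_add b1 b2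
    _ = |κ| * s * (64 * π ^ 2 + π ^ 2 * Fintype.card J) := by rw [← hns]; ring

end Lattice

end Summit.QuantumFields.YangMills.BalabanUVNodes.N15.Gluing

end
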